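import Summits.BirchSwinnertonDyer.BirchSwinnertonDyer.Theorems.PrintCFramBottomClassIndexLawFiveLeSelmerCountCaseS
import Literature.NumberTheory.GaloisRepresentations.DecompositionGroupOfCompletion
import HarnessLib

/-!
# Route `PrintCFram`, crux C2 `BottomClassIndexLawFiveLe` (stmt-BirchSwinnertonDyer-20372), line
# `eisenstein-resource-bdp-line` (registry v19, stub B1 `stub_bsdp_of_classFactor`): **THE SELMER COUNT ON THE CLASS, EVEN-REGULAR
# MEMBERS (case-free)** — `v_p(B_{1,ψ⁻¹}) = 1 ∧ EVEN-REGULAR ⟹ #Sel_p(W/ℚ) ≤ p²`, hence (parity split) `B1 ⟸ p ∤ #Ш_an(W)` there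
# (cell `bsd-print-cfram`, width seat `bsd-line-cfram-p1-w2` g10; helper `--supports` 20372; 0 defs, 0 facts, 0 sorry;
# CONDITIONAL on Mazur–Wiles Thm 2 (`hMW`) and, for the `BSD_p` corollaries, on Cassels–Tate (`hCT`) and GZK)

HONEST FRAMING. Nothing about BSD is proved unconditionally here and no stub is closed; B1 is NOT proved (its residue on this
branch is the `p`-indivisibility of `#Ш_an(W)`, i.e. the Heegner `p`-primitivity — w3 g8/g9's sockets). This is the COMPLEMENT of
seat g9's `…SelmerCountCaseS` in B1's first-order Selmer census. There, the hypothesis was CASE S (the model with odd sub character is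
TRANSVERSE at `p`) and NOTHING was assumed on the even character; here NO CASE HYPOTHESIS is made (the both-strict dévissage count
`SelmerCount.natCard_selmerGroup_le_prime_mul_natCard_strict`, `dim Sel_p(W/ℚ) ≤ 1 + u_str(θ_Q) + u_str(θ_S)`, holds for every model) and
instead the EVEN constituent `θ_e = ω ψ⁻¹` of `W[p]` is assumed REGULAR:

EVEN-REGULAR(`W`,`p`) := «for every `Γ_ℚ`-stable line `Φ ≤ W[p]` of order `p` and every complex conjugation `c`: if `c` acts trivially on `Φ`
then `H¹(Γ_ℚ, Φ; ∅)` (the everywhere-unramified classes, `h1Unramified Φ.Sub ∅`) has at most one element; if `c` acts by `−1` on `Φ` then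
`H¹(Γ_ℚ, W[p]/Φ; ∅)` has at most one element» — i.e. the even one of the two characters of the rational line carries no non-zero
everywhere-unramified class (`u_str(θ_e) = 0`). In class-group currency this is `p ∤ #e_{θ̃_e}(ℤ_p ⊗ Cl_L)` for the field `L` cut out by
`θ_e` (sibling file `…SelmerCountEvenRegularClassGroup`, via w7 g3's MW-free Hilbert-class-field count `HerbrandOddClassGroup.finite_and_natCard_le_classGroupChiCard_of_unramified_characters`
— which needs NO parity — and the bridge of seat g9); by Leopoldt's reflection `u(θ_e) ∈ {u(ψ) − 1, u(ψ)}`, so at `v_p(B_{1,ψ⁻¹}) = 1` this is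
the alternative `u(θ_e) = 0` of seat notes w2g8 §4 / w2g9 §2 («CASE R needs `u(θ_e) = 0`»).

* §1 **`natCard_selmerGroup_le_sq_of_evenRegular`** — `W/ℚ` globally minimal with CM, `p ≥ 5` CM-ramified, odd Kriz–Li datum `(f, ψ, ω)` with
  `hss`, **`‖B_{1,ψ⁻¹}‖_p = p⁻¹`**, `hMW`, `v ∋ p`, EVEN-REGULAR ⊢ **`#Sel_p(W/ℚ) ≤ p²`** (for BOTH models of the `p`-isogenous pair, aligned or
  transverse alike). Proof: rational line data (w6 g3 `exists_rationalLineData_of_hss`), `W(ℚ_p)[p] = 0` and `Φ.Quot^{D_p} = 0` on the class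
  (`prime_nsmul_eq_zero_padic_of_hasCM_of_cmRamified`; the inertia homothety at `𝔓₀ = adicCompletionPrime ℚ v`, whose decomposition group IS
  `decomp v` — cf. w6 g4's `…SelmerCountCaseSLocal`), the both-strict count, the ODD strict count `≤ p` (w7 g3 + MW) on the odd character and
  EVEN-REGULAR (`≤ 1`) on the even one (`R_str ≤ h1Unramified ∅`, seat g9).
* §2 corollaries, modulo `hCT` + `hGZK` + `r_an = 1` (w2 g8 / w3 g8 `ParitySplit`): **`bsdp_of_evenRegular_of_shaAnUnit`**
  (`p ∤ #Ш_an(W) ⟹ BSDp W p`), **`sha_noPTorsion_of_evenRegular`** (`Ш(W)[p] = 0`), **`bsdp_iff_shaAnUnit_of_evenRegular`**,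
  **`bsdp_of_sha_ne_zero_of_evenRegular`** (LEAD g11's B1-sha is vacuous there).
* The dictionary to class groups (EVEN-REGULAR ⟸ `#e_{θ̃_e}(ℤ_p ⊗ Cl_L) = 1`, any parity, MW-free) is the sibling file
  `…SelmerCountEvenRegularClassGroup` (`SelmerCount.natCard_h1Unramified_empty_le_classGroupChiCard_of_avatar`).

NET (with `…CaseS`): at `v_p(B_{1,ψ⁻¹}) = 1`, modulo MW + CT + GZK, a B1 member lies on the small-Selmer branch (`Ш(W)[p] = 0`,
`BSD_p ⟺ p ∤ #Ш_an(W)` ⟺ Heegner `p`-primitivity) as soon as it is in CASE S **or** EVEN-REGULAR; the residual first-order locus of B1 is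
«CASE R ∧ EVEN-IRREGULAR» (there `dim Sel_p(W_ψ) ≥ 2` is expected — the lower bound is the sequel `…SelmerCountLowerBound`).

THEOREMS ONLY; no definition, no named fact, no `sorry`. BSD is not proved by any of this; no summit statement is proved by this seat.
References: [SilvermanAEC2009] X.§4; [MazurWiles1984] Thm. 2 (p. 216); [Washington1997] §6.3, §10.2 (Thm. 10.9, reflection);
[Cassels1962ArithmeticIV]; [GreenbergLNM1716] §3; [NeukirchANT1999] Ch. II §9 (9.6), Ch. VI §7 (7.1); [KrizLi2019] §1.5; the LEAD g10
report §2, seat notes w2g8 §4, w2g9 §2, w7g3.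
-/

set_option autoImplicit false
-- `…BirchSwinnertonDyer.BirchSwinnertonDyer.Theorems…` is the problem's mandated namespace (D-0017).
set_option linter.dupNamespace false

noncomputable section

open scoped Classical Pointwise

namespace Summit.BirchSwinnertonDyer.BirchSwinnertonDyer.Theorems.PrintCFram.SelmerCount

open NumberField IsDedekindDomain Field WeierstrassCurve DirichletCharacter
open Literature.NumberTheory.NumberFields Literature.NumberTheory.EllipticCurves Literature.NumberTheory.GaloisRepresentations
  Literature.NumberTheory.EllipticCurves.Rank1Residual Literature.NumberTheory.EllipticCurves.KrizLi2019
  Literature.NumberTheory.EllipticCurves.GreenbergSelmer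
open Summit.BirchSwinnertonDyer.Rank1Residual Summit.BirchSwinnertonDyer.Rank1Residual.X2.ResidualDevissageModules
open Summit.BirchSwinnertonDyer.BirchSwinnertonDyer.Theorems.PrintCFram.HerbrandSelmerToHom
open Summit.BirchSwinnertonDyer.BirchSwinnertonDyer.Theorems.PrintCFram.LevelDictionaryAlpha

variable {p : ℕ} [hp : Fact p.Prime]

/-! ## §1 The both-strict count on the class under EVEN-REGULARITY: `#Sel_p(W/ℚ) ≤ p²` -/

section Class

variable (W : WeierstrassCurve ℚ) [W.IsElliptic] [W.IsGloballyMinimal]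

/-- **THE SELMER COUNT ON THE CLASS, EVEN-REGULAR MEMBERS: `#Sel_p(W/ℚ) ≤ p²` (no case hypothesis).** `W/ℚ` globally minimal with CM,
`p ≥ 5` ramified in the CM field, `(f, ψ, ω)` a Kriz–Li character datum with `ψ` ODD, `ω` Teichmüller and the trace form `hss`; the class
factor has EXACT valuation one, `‖B_{1,ψ⁻¹}‖_p = p⁻¹`; `hMW` (Mazur–Wiles Thm 2); `v` the place above `p`; and EVEN-REGULAR: for every
`Γ_ℚ`-stable line `Φ ≤ W[p]` of order `p` and every complex conjugation `c`, if `c` acts trivially on `Φ` then `#H¹(Γ_ℚ, Φ; ∅) ≤ 1`, and if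
`c` acts by `−1` on `Φ` then `#H¹(Γ_ℚ, W[p]/Φ; ∅) ≤ 1`. THEN `#Sel_p(W/ℚ) ≤ p²`. PROOF: the rational line `Φ = W[𝔭]` with characters
`θ_S, θ_Q` and avatars (`exists_rationalLineData_of_hss`); the both-strict count `#Sel_p ≤ p · #R_str(Φ.Quot) · #R_str(Φ.Sub)`
(`natCard_selmerGroup_le_prime_mul_natCard_strict`, with `W(ℚ_p)[p] = 0`, `Φ.Quot^{D_p} = 0` and the bad-place inputs of the class);
`R_str ≤ H¹(·; ∅)`; the ODD one of `θ_S, θ_Q` has `#R_str ≤ p` (Hilbert class field count + MW, `SelmerCountClassSide.natCard_strict_le_pow_of_odd_avatar`),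
the EVEN one has `#R_str ≤ 1` by EVEN-REGULAR. In dimensions: `dim Sel_p ≤ 1 + 0 + 1`.
[cite: SilvermanAEC2009, X.§4 (Cor. 4.4, Ex. 4.8)] [cite: MazurWiles1984, Thm. 2 (p. 216)] [cite: BhargavaSkinner2014, proof of Lemma 16]
[cite: GreenbergLNM1716, §3 (PDF p. 86)] -/
theorem natCard_selmerGroup_le_sq_of_evenRegular (hMW : MazurWiles1984.thm2_card_oddChiClassGroup_eq_bernoulli)
    (hCM : W.HasCM) (hram : CMRamified W p) (h5 : 5 ≤ p)
    {f : ℕ} [NeZero f] (ψ : DirichletCharacter ℚ_[p] f) (ω : DirichletCharacter ℚ_[p] p)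
    (hψ : ψ.Odd) (hω : IsTeichmullerCharacter ω)
    (hss : ∀ ℓ : ℕ, ℓ.Prime → ¬ (ℓ ∣ p * W.conductorNorm ℤ) →
      ‖((W.LFunction ℓ : ℤ) : ℚ_[p]) - (ψ (ℓ : ZMod f) + ψ⁻¹ (ℓ : ZMod f) * ω (ℓ : ZMod p))‖ < 1)
    (hB : ‖bernoulliOnePrim ψ⁻¹‖ = (p : ℝ)⁻¹)
    {v : HeightOneSpectrum (𝓞 ℚ)} (hpv : ((p : ℕ) : 𝓞 ℚ) ∈ v.asIdeal)
    (hE : ∀ (Φ : StableSubgroup (absoluteGaloisGroup ℚ) (geomTorsion W (p : ℤ))), Nat.card Φ.Sub = p →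
      ∀ c : absoluteGaloisGroup ℚ, IsComplexConjugation (Rat.castHom ℝ) c →
        ((∀ x : Φ.Sub, c • x = x) →
          Nat.card ↥(h1Unramified Φ.Sub (∅ : Set (HeightOneSpectrum (𝓞 ℚ)))) ≤ 1) ∧
        ((∀ x : Φ.Sub, c • x = -x) →
          Nat.card ↥(h1Unramified Φ.Quot (∅ : Set (HeightOneSpectrum (𝓞 ℚ)))) ≤ 1)) :
    Nat.card (selmerGroup W (p : ℤ)) ≤ p ^ 2 := by
  have hpr : p.Prime := hp.out
  have hp2 : p ≠ 2 := by omega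
  haveI hpne : NeZero p := ⟨hpr.ne_zero⟩
  haveI : Fact (1 < p) := ⟨hpr.one_lt⟩
  have hωodd : ω.Odd := KrizLiBinders.teichmuller_apply_neg_one hp2 hω
  have hne : ¬ ψ.Even := EisensteinPair.not_even_of_odd' ψ hψ
  have hBp : ‖bernoulliOnePrim ψ⁻¹‖ = ((p : ℝ) ^ 1)⁻¹ := by rw [pow_one]; exact hB
  -- the rational line, its characters and avatars
  obtain ⟨Φ, θS, θQ, m, hmz, b, ψ₁, hfM, hmM, hpM, hcard, hθS, hkerS, hθQ, hkerQ, hprod, hSb, hQb, hψ₁, e⟩ :=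
    exists_rationalLineData_of_hss p W hCM h5 hram ψ ω hω hss
  have hcardQ : Nat.card Φ.Quot = p := HerbrandLineRestriction.natCard_quot_eq_of_card_sub W Φ hcard
  have hcontS : ∀ x : Φ.Sub, Continuous fun g : absoluteGaloisGroup ℚ ↦ g • x :=
    Φ.continuous_smul_sub (LevelDictionary.continuous_smul_geomTorsion W (p : ℤ))
  have hcontQ : ∀ y : Φ.Quot, Continuous fun g : absoluteGaloisGroup ℚ ↦ g • y :=
    Φ.continuous_smul_quot (LevelDictionary.continuous_smul_geomTorsion W (p : ℤ))
  have hpS : ∀ x : Φ.Sub, (p : ℤ) • x = 0 := fun x ↦ by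
    rw [natCast_zsmul]; exact HerbrandLineRestriction.prime_nsmul_eq_zero_of_card_prime hcard x
  -- non-trivial action and the decomposition witnesses at `p`
  obtain ⟨𝔓₀, h𝔓₀⟩ := v.primesAbove_nonempty
  obtain ⟨g₀, -, -, c₀, hc₀, hg₀⟩ := BorelTorsion.exists_sq_mem_inertia_homothety (W := W) p hCM h5 hram hpv h𝔓₀
  have hntS : ∃ (g : absoluteGaloisGroup ℚ) (x : Φ.Sub), g • x ≠ x := by
    haveI : Finite Φ.Sub := Nat.finite_of_card_ne_zero (by rw [hcard]; exact hpr.ne_zero)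
    haveI : Nontrivial Φ.Sub := Finite.one_lt_card_iff_nontrivial.mp (by rw [hcard]; exact hpr.one_lt)
    obtain ⟨x, hx⟩ := exists_ne (0 : Φ.Sub)
    exact ⟨g₀, x, HerbrandInertiaAtP.smul_ne_sub_of_homothety W Φ hcard hc₀ hg₀ hx⟩
  have hntQ : ∃ (g : absoluteGaloisGroup ℚ) (y : Φ.Quot), g • y ≠ y := by
    haveI : Finite Φ.Quot := Nat.finite_of_card_ne_zero (by rw [hcardQ]; exact hpr.ne_zero)
    haveI : Nontrivial Φ.Quot := Finite.one_lt_card_iff_nontrivial.mp (by rw [hcardQ]; exact hpr.one_lt)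
    obtain ⟨y, hy⟩ := exists_ne (0 : Φ.Quot)
    exact ⟨g₀, y, HerbrandInertiaAtP.smul_ne_quot_of_homothety W Φ hcard hc₀ hg₀ hy⟩
  -- a complex conjugation and the parities of the two characters
  obtain ⟨c, hc⟩ := exists_isComplexConjugation (Rat.castHom ℝ)
  have hmc : modNCyclotomicCharacter ℚ m c = -1 :=
    Units.ext (by rw [Units.val_neg, Units.val_one]; exact modNCyclotomicCharacter_of_isComplexConjugation hc)
  have hpc : modNCyclotomicCharacter ℚ p c = -1 :=
    Units.ext (by rw [Units.val_neg, Units.val_one]; exact modNCyclotomicCharacter_of_isComplexConjugation hc)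
  have hSc : θS c = b (-1) := by rw [hSb c, hmc]
  have hpar := BernoulliUnits.odd_iff_of_teichmuller_lift hp2 b hψ₁
  -- the avatars: `ψ₁` for `θS`, `λ₃ = ψ₁⁻¹↑·ω↑` (level `m·p`) for `θQ`
  haveI : NeZero (m * p) := ⟨Nat.mul_ne_zero (NeZero.ne m) hpr.ne_zero⟩
  have hlamS : ∀ τ : absoluteGaloisGroup ℚ, ψ₁ ((modNCyclotomicCharacter ℚ m τ : (ZMod m)ˣ) : ZMod m) =
      (((Kato2004.teichmullerChar p (θS τ) : ℤ_[p]ˣ) : ℤ_[p]) : ℚ_[p]) := fun τ ↦ by rw [hSb τ, hψ₁]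
  set lam₃ : DirichletCharacter ℚ_[p] (m * p) := changeLevel (dvd_mul_right m p) ψ₁⁻¹ * changeLevel (dvd_mul_left p m) ω
    with hlam₃
  have el₃ : changeLevel (dvd_refl (m * p)) lam₃ = changeLevel (dvd_mul_right m p) ψ₁⁻¹ * changeLevel (dvd_mul_left p m) ω := by
    rw [hlam₃, changeLevel_self]
  have hlamQ : ∀ τ : absoluteGaloisGroup ℚ, lam₃ ((modNCyclotomicCharacter ℚ (m * p) τ : (ZMod (m * p))ˣ) : ZMod (m * p)) =
      (((Kato2004.teichmullerChar p (θQ τ) : ℤ_[p]ˣ) : ℤ_[p]) : ℚ_[p]) := fun τ ↦ by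
    rw [hQb τ]
    exact (BernoulliUnits.avatar_level_of_lift_psiInvOmega hp2 b hψ₁ hω (dvd_refl (m * p)) (dvd_mul_right m p)
      (dvd_mul_left p m) lam₃ el₃ τ).symm
  -- common-level bookkeeping (`M = f·m·p`)
  have hmpM : m * p ∣ f * m * p := ⟨f, by ring⟩
  have hL₃ : changeLevel hmpM lam₃ = changeLevel hmM ψ₁⁻¹ * changeLevel hpM ω := by
    rw [hlam₃, map_mul, ← changeLevel_trans, ← changeLevel_trans]
  -- the class-side local inputs: at `p` and at the bad places `≠ p`
  -- (`W(ℚ_p)[p] = 0` and `Φ.Quot^{D_p} = 0`: also w6 g4's `natCard_ker_nsmul_adicCompletion_eq_one_of_cmRamified`,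
  -- `quot_eq_zero_of_forall_decomp_smul_eq_of_cmRamified` in `…SelmerCountCaseSLocal`, landed while this file was written)
  have htors : Nat.card (nsmulAddMonoidHom p :
      (W.baseChange (v.adicCompletion ℚ)).toAffine.Point →+ _).ker = 1 :=
    (W.natCard_ker_nsmul_adicCompletion_eq_one_iff hpv p).2
      (RamifiedSevenEllipticUnits.prime_nsmul_eq_zero_padic_of_hasCM_of_cmRamified W p hCM h5 hram)
  have hQD : ∀ q : Φ.Quot, (∀ g ∈ decomp v, g • q = q) → q = 0 := fun q hq ↦
    quot_eq_zero_of_forall_inertia_smul_eq_at_p W Φ hCM h5 hram hcard hpv (adicCompletionPrime_mem_primesAbove ℚ v) q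
      fun g hg ↦ hq g (by
        have h := Ideal.inertia_le_decompositionSubgroup (absoluteGaloisGroup ℚ) (adicCompletionPrime ℚ v) hg
        rw [decompositionSubgroup_adicCompletionPrime_eq_range] at h
        exact h)
  have hbad' : ∀ v' : HeightOneSpectrum (𝓞 ℚ), ¬ W.HasGoodReductionAt v' → ((p : ℕ) : 𝓞 ℚ) ∉ v'.asIdeal →
      ∀ P : (W.baseChange (v'.adicCompletion ℚ)).toAffine.Point, p • P = 0 → P = 0 :=
    fun v' hg hpv' ↦ forall_prime_nsmul_eq_zero_adicCompletion_of_bad (K := ℚ) W hCM hram h5 hpv' hg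
  have hQI' : ∀ v' : HeightOneSpectrum (𝓞 ℚ), ¬ W.HasGoodReductionAt v' → ((p : ℕ) : 𝓞 ℚ) ∉ v'.asIdeal →
      ∀ 𝔓 ∈ v'.primesAbove, ∀ q : Φ.Quot,
        (∀ g ∈ 𝔓.inertia (absoluteGaloisGroup ℚ), g • q = q) → q = 0 :=
    fun v' hg hpv' 𝔓 h𝔓 q hq ↦ quot_eq_zero_of_forall_inertia_smul_eq_of_bad (K := ℚ) W Φ hCM hram h5 hpv' hg h𝔓 q hq
  -- the both-strict count
  have hcount := natCard_selmerGroup_le_prime_mul_natCard_strict W hpv htors Φ hQD hbad' hQI'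
  -- `R_str ≤ H¹(·; ∅)` and finiteness
  haveI : Finite Φ.Sub := Nat.finite_of_card_ne_zero (by rw [hcard]; exact hpr.ne_zero)
  haveI : Finite Φ.Quot := Nat.finite_of_card_ne_zero (by rw [hcardQ]; exact hpr.ne_zero)
  haveI : Finite ↥(h1Unramified Φ.Sub (∅ : Set (HeightOneSpectrum (𝓞 ℚ)))) :=
    finite_h1Unramified_of_continuous Φ.Sub hcontS Set.finite_empty
  haveI : Finite ↥(h1Unramified Φ.Quot (∅ : Set (HeightOneSpectrum (𝓞 ℚ)))) :=
    finite_h1Unramified_of_continuous Φ.Quot hcontQ Set.finite_empty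
  have hleS : Nat.card ↥(h1Unramified Φ.Sub {v' : HeightOneSpectrum (𝓞 ℚ) | ((p : ℕ) : 𝓞 ℚ) ∈ v'.asIdeal} ⊓
        subgroupResKer Φ.Sub (decomp v)) ≤ Nat.card ↥(h1Unramified Φ.Sub (∅ : Set (HeightOneSpectrum (𝓞 ℚ)))) :=
    Nat.card_le_card_of_injective _ (AddSubgroup.inclusion_injective (inf_subgroupResKer_decomp_le_h1Unramified_empty Φ.Sub hpv))
  have hleQ : Nat.card ↥(h1Unramified Φ.Quot {v' : HeightOneSpectrum (𝓞 ℚ) | ((p : ℕ) : 𝓞 ℚ) ∈ v'.asIdeal} ⊓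
        subgroupResKer Φ.Quot (decomp v)) ≤ Nat.card ↥(h1Unramified Φ.Quot (∅ : Set (HeightOneSpectrum (𝓞 ℚ)))) :=
    Nat.card_le_card_of_injective _ (AddSubgroup.inclusion_injective (inf_subgroupResKer_decomp_le_h1Unramified_empty Φ.Quot hpv))
  rcases e with e | e
  · -- `ψ ~ ψ₁`: the SUB character `θS` is ODD, the QUOTIENT character is the EVEN one
    have hψ₁odd : ψ₁.Odd := by
      unfold DirichletCharacter.Odd
      rw [BernoulliUnits.apply_neg_one_eq_of_changeLevel_eq hmM ψ₁ e.symm, EisensteinPair.changeLevel_apply_neg_one]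
      exact hψ
    have hb1 : b (-1) = -1 := hpar.1.mp hψ₁odd
    have hθSc : θS c = -1 := by rw [hSc, hb1]
    have hcx : ∀ x : Φ.Sub, c • x = -x := by
      intro x
      rw [hθS c x, hθSc, Units.val_neg, Units.val_one, ZMod.neg_val', ZMod.val_one,
        Nat.mod_eq_of_lt (Nat.sub_lt hpr.pos Nat.one_pos), Nat.cast_sub hpr.one_lt.le, Nat.cast_one, sub_smul,
        one_smul, hpS, zero_sub]
    -- quotient (even): `≤ 1` by EVEN-REGULAR; sub (odd): `≤ p` by the odd strict count
    have hQ : Nat.card ↥(h1Unramified Φ.Quot {v' : HeightOneSpectrum (𝓞 ℚ) | ((p : ℕ) : 𝓞 ℚ) ∈ v'.asIdeal} ⊓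
        subgroupResKer Φ.Quot (decomp v)) ≤ 1 := hleQ.trans ((hE Φ hcard c hc).2 hcx)
    have hB₁ : ‖bernoulliOnePrim ψ₁⁻¹‖ = ((p : ℝ) ^ 1)⁻¹ := by
      rw [BernoulliUnits.bernoulliOnePrim_inv_eq_of_lift_psi hmM hfM ψ₁ ψ (1 : DirichletCharacter ℚ_[p] 1) e.symm hψ,
        RegularLocusBernoulliPair.bernoulliOnePrim_bernoulliCharOne_of_not_even ψ _ hne]
      exact hBp
    have hSu := SelmerCountClassSide.natCard_strict_le_pow_of_odd_avatar hMW hp2 hcard hcontS hntS θS hθS hkerS ψ₁ hlamS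
      hψ₁odd hB₁ hpv
    calc Nat.card (selmerGroup W (p : ℤ)) ≤ _ := hcount
      _ ≤ p * (1 * p ^ 1) := Nat.mul_le_mul_left p (Nat.mul_le_mul hQ hSu)
      _ = p ^ 2 := by rw [one_mul, pow_one, pow_two]
  · -- `ψ ~ ψ₁⁻¹ω`: the SUB character `θS` is EVEN, the QUOTIENT character is the ODD one
    have hL₁ : changeLevel hmM ψ₁ = changeLevel hfM ψ⁻¹ * changeLevel hpM ω := by
      rw [map_inv, e, map_inv, mul_inv, inv_inv, inv_mul_cancel_right]
    have hψ₁even : ψ₁.Even := by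
      unfold DirichletCharacter.Even
      rw [BernoulliUnits.apply_neg_one_eq_of_changeLevel_eq hmM ψ₁ hL₁, MulChar.mul_apply, map_inv,
        MulChar.inv_apply_eq_inv', EisensteinPair.changeLevel_apply_neg_one, EisensteinPair.changeLevel_apply_neg_one,
        hψ, hωodd, inv_neg, inv_one, neg_mul_neg, one_mul]
    have hb1 : b (-1) = 1 := hpar.2.mp hψ₁even
    have hθSc : θS c = 1 := by rw [hSc, hb1]
    have hcx : ∀ x : Φ.Sub, c • x = x := by
      intro x
      rw [hθS c x, hθSc, Units.val_one, ZMod.val_one, Nat.cast_one, one_smul]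
    -- sub (even): `≤ 1` by EVEN-REGULAR; quotient (odd): `≤ p` by the odd strict count on `λ₃ ~ ψ`
    have hSu : Nat.card ↥(h1Unramified Φ.Sub {v' : HeightOneSpectrum (𝓞 ℚ) | ((p : ℕ) : 𝓞 ℚ) ∈ v'.asIdeal} ⊓
        subgroupResKer Φ.Sub (decomp v)) ≤ 1 := hleS.trans ((hE Φ hcard c hc).1 hcx)
    have hL₃' : changeLevel hmpM lam₃ = changeLevel hfM ψ := by rw [hL₃, ← e]
    have hodd₃ : lam₃.Odd := by
      unfold DirichletCharacter.Odd
      rw [BernoulliUnits.apply_neg_one_eq_of_changeLevel_eq hmpM lam₃ hL₃', EisensteinPair.changeLevel_apply_neg_one]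
      exact hψ
    have hB₃ : ‖bernoulliOnePrim lam₃⁻¹‖ = ((p : ℝ) ^ 1)⁻¹ := by
      rw [BernoulliUnits.bernoulliOnePrim_inv_eq_of_lift_psi hmpM hfM lam₃ ψ (1 : DirichletCharacter ℚ_[p] 1) hL₃' hψ,
        RegularLocusBernoulliPair.bernoulliOnePrim_bernoulliCharOne_of_not_even ψ _ hne]
      exact hBp
    have hQ := SelmerCountClassSide.natCard_strict_le_pow_of_odd_avatar hMW hp2 hcardQ hcontQ hntQ θQ hθQ hkerQ lam₃ hlamQ
      hodd₃ hB₃ hpv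
    calc Nat.card (selmerGroup W (p : ℤ)) ≤ _ := hcount
      _ ≤ p * (p ^ 1 * 1) := Nat.mul_le_mul_left p (Nat.mul_le_mul hQ hSu)
      _ = p ^ 2 := by rw [mul_one, pow_one, pow_two]

/-! ## §2 The glue with the parity split (modulo Cassels–Tate and GZK) -/

/-- **B1 ON THE EVEN-REGULAR BRANCH, modulo Mazur–Wiles, Cassels–Tate and GZK: `BSD(W,p)` from `p ∤ #Ш_an(W)`.** Same class member and
datum, `‖B_{1,ψ⁻¹}‖_p = p⁻¹`, EVEN-REGULAR, `hMW`; moreover `r_an(W) = 1`, the Cassels–Tate pairing (`hCT`), Gross–Zagier–Kolyvagin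
(`hGZK`) and `#Ш_an(W) = q ∈ ℚ` with `padicValRat p q = 0`. THEN `BSDp W p` (`natCard_selmerGroup_le_sq_of_evenRegular` + w2 g8's
`ParitySplit.bsdp_of_natCard_selmerGroup_le_sq`). [cite: Cassels1962ArithmeticIV] [cite: Miller2011LMS, Def. 1.1]
[cite: MazurWiles1984, Thm. 2 (p. 216)] -/
theorem bsdp_of_evenRegular_of_shaAnUnit (hMW : MazurWiles1984.thm2_card_oddChiClassGroup_eq_bernoulli)
    (hCT : exists_casselsTate_pairing (K := ℚ)) (hGZK : rank_eq_analyticRank_of_analyticRank_le_one)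
    (hCM : W.HasCM) (hram : CMRamified W p) (h5 : 5 ≤ p) (hr : W.analyticRank = 1)
    {f : ℕ} [NeZero f] (ψ : DirichletCharacter ℚ_[p] f) (ω : DirichletCharacter ℚ_[p] p)
    (hψ : ψ.Odd) (hω : IsTeichmullerCharacter ω)
    (hss : ∀ ℓ : ℕ, ℓ.Prime → ¬ (ℓ ∣ p * W.conductorNorm ℤ) →
      ‖((W.LFunction ℓ : ℤ) : ℚ_[p]) - (ψ (ℓ : ZMod f) + ψ⁻¹ (ℓ : ZMod f) * ω (ℓ : ZMod p))‖ < 1)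
    (hB : ‖bernoulliOnePrim ψ⁻¹‖ = (p : ℝ)⁻¹)
    {q : ℚ} (hq : shaAn W = (q : ℂ)) (hvq : padicValRat p q = 0)
    {v : HeightOneSpectrum (𝓞 ℚ)} (hpv : ((p : ℕ) : 𝓞 ℚ) ∈ v.asIdeal)
    (hE : ∀ (Φ : StableSubgroup (absoluteGaloisGroup ℚ) (geomTorsion W (p : ℤ))), Nat.card Φ.Sub = p →
      ∀ c : absoluteGaloisGroup ℚ, IsComplexConjugation (Rat.castHom ℝ) c →
        ((∀ x : Φ.Sub, c • x = x) →
          Nat.card ↥(h1Unramified Φ.Sub (∅ : Set (HeightOneSpectrum (𝓞 ℚ)))) ≤ 1) ∧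
        ((∀ x : Φ.Sub, c • x = -x) →
          Nat.card ↥(h1Unramified Φ.Quot (∅ : Set (HeightOneSpectrum (𝓞 ℚ)))) ≤ 1)) :
    BSDp W p :=
  ParitySplit.bsdp_of_natCard_selmerGroup_le_sq W p hCT hGZK hr hq hvq
    (natCard_selmerGroup_le_sq_of_evenRegular W hMW hCM hram h5 ψ ω hψ hω hss hB hpv hE)

/-- **ON THE EVEN-REGULAR BRANCH `Ш(W)[p] = 0`, modulo Mazur–Wiles, Cassels–Tate and GZK.** Same class member and datum,
`‖B_{1,ψ⁻¹}‖_p = p⁻¹`, EVEN-REGULAR, `hMW`, `r_an(W) = 1`, `hCT`, `hGZK`: every element of `Ш(W/ℚ)` killed by `p` is zero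
(`natCard_selmerGroup_le_sq_of_evenRegular` + w3 g8's `ParitySplit.noPTorsion_of_natCard_selmerGroup_le_sq`: `dim_𝔽_p Ш[p]` is even). So on this
branch the (β) alternative «`Ш(W)[p] ≠ 0`» of the level dictionary is EXCLUDED: (β) forces LEVEL `≥ 1` for `W` or its partner.
[cite: Cassels1962ArithmeticIV] [cite: MazurWiles1984, Thm. 2 (p. 216)] -/
theorem sha_noPTorsion_of_evenRegular (hMW : MazurWiles1984.thm2_card_oddChiClassGroup_eq_bernoulli)
    (hCT : exists_casselsTate_pairing (K := ℚ)) (hGZK : rank_eq_analyticRank_of_analyticRank_le_one)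
    (hCM : W.HasCM) (hram : CMRamified W p) (h5 : 5 ≤ p) (hr : W.analyticRank = 1)
    {f : ℕ} [NeZero f] (ψ : DirichletCharacter ℚ_[p] f) (ω : DirichletCharacter ℚ_[p] p)
    (hψ : ψ.Odd) (hω : IsTeichmullerCharacter ω)
    (hss : ∀ ℓ : ℕ, ℓ.Prime → ¬ (ℓ ∣ p * W.conductorNorm ℤ) →
      ‖((W.LFunction ℓ : ℤ) : ℚ_[p]) - (ψ (ℓ : ZMod f) + ψ⁻¹ (ℓ : ZMod f) * ω (ℓ : ZMod p))‖ < 1)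
    (hB : ‖bernoulliOnePrim ψ⁻¹‖ = (p : ℝ)⁻¹)
    {v : HeightOneSpectrum (𝓞 ℚ)} (hpv : ((p : ℕ) : 𝓞 ℚ) ∈ v.asIdeal)
    (hE : ∀ (Φ : StableSubgroup (absoluteGaloisGroup ℚ) (geomTorsion W (p : ℤ))), Nat.card Φ.Sub = p →
      ∀ c : absoluteGaloisGroup ℚ, IsComplexConjugation (Rat.castHom ℝ) c →
        ((∀ x : Φ.Sub, c • x = x) →
          Nat.card ↥(h1Unramified Φ.Sub (∅ : Set (HeightOneSpectrum (𝓞 ℚ)))) ≤ 1) ∧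
        ((∀ x : Φ.Sub, c • x = -x) →
          Nat.card ↥(h1Unramified Φ.Quot (∅ : Set (HeightOneSpectrum (𝓞 ℚ)))) ≤ 1)) :
    ∀ x : W.sha, (p : ℤ) • x = 0 → x = 0 :=
  ParitySplit.noPTorsion_of_natCard_selmerGroup_le_sq W p hCT hGZK hr
    (natCard_selmerGroup_le_sq_of_evenRegular W hMW hCM hram h5 ψ ω hψ hω hss hB hpv hE)

/-- **ON THE EVEN-REGULAR BRANCH, `BSD(W,p) ⟺ p ∤ #Ш_an(W)`** (modulo Mazur–Wiles, Cassels–Tate, GZK) — LEAD g11's reading (22:11:05Z (1):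
«on B1 ∩ {#Sel_p ≤ p²}, BSD_p ⟺ p ∤ #Ш_an(W)») with its Selmer condition discharged from `‖B_{1,ψ⁻¹}‖_p = p⁻¹` and EVEN-REGULARITY
(`natCard_selmerGroup_le_sq_of_evenRegular` + w3 g8's `ParitySplit.bsdp_iff_shaAn_unit_of_natCard_selmerGroup_le_sq`).
[cite: Cassels1962ArithmeticIV] [cite: Miller2011LMS, Def. 1.1] [cite: MazurWiles1984, Thm. 2 (p. 216)] -/
theorem bsdp_iff_shaAnUnit_of_evenRegular (hMW : MazurWiles1984.thm2_card_oddChiClassGroup_eq_bernoulli)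
    (hCT : exists_casselsTate_pairing (K := ℚ)) (hGZK : rank_eq_analyticRank_of_analyticRank_le_one)
    (hCM : W.HasCM) (hram : CMRamified W p) (h5 : 5 ≤ p) (hr : W.analyticRank = 1)
    {f : ℕ} [NeZero f] (ψ : DirichletCharacter ℚ_[p] f) (ω : DirichletCharacter ℚ_[p] p)
    (hψ : ψ.Odd) (hω : IsTeichmullerCharacter ω)
    (hss : ∀ ℓ : ℕ, ℓ.Prime → ¬ (ℓ ∣ p * W.conductorNorm ℤ) →
      ‖((W.LFunction ℓ : ℤ) : ℚ_[p]) - (ψ (ℓ : ZMod f) + ψ⁻¹ (ℓ : ZMod f) * ω (ℓ : ZMod p))‖ < 1)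
    (hB : ‖bernoulliOnePrim ψ⁻¹‖ = (p : ℝ)⁻¹)
    {v : HeightOneSpectrum (𝓞 ℚ)} (hpv : ((p : ℕ) : 𝓞 ℚ) ∈ v.asIdeal)
    (hE : ∀ (Φ : StableSubgroup (absoluteGaloisGroup ℚ) (geomTorsion W (p : ℤ))), Nat.card Φ.Sub = p →
      ∀ c : absoluteGaloisGroup ℚ, IsComplexConjugation (Rat.castHom ℝ) c →
        ((∀ x : Φ.Sub, c • x = x) →
          Nat.card ↥(h1Unramified Φ.Sub (∅ : Set (HeightOneSpectrum (𝓞 ℚ)))) ≤ 1) ∧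
        ((∀ x : Φ.Sub, c • x = -x) →
          Nat.card ↥(h1Unramified Φ.Quot (∅ : Set (HeightOneSpectrum (𝓞 ℚ)))) ≤ 1)) :
    BSDp W p ↔ ∃ q : ℚ, shaAn W = (q : ℂ) ∧ padicValRat p q = 0 :=
  ParitySplit.bsdp_iff_shaAn_unit_of_natCard_selmerGroup_le_sq W p hCT hGZK hr
    (natCard_selmerGroup_le_sq_of_evenRegular W hMW hCM hram h5 ψ ω hψ hω hss hB hpv hE)

/-- **LEAD g11's «B1-sha» is VACUOUS on the even-regular branch.** In the currency of `EisensteinEndStateV19Binders` (B1-sha :=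
«class member, `r_an = 1`, `∃ s ∈ W.sha, s ≠ 0 ∧ p • s = 0` ⟹ `BSDp W p`»): for a member with `‖B_{1,ψ⁻¹}‖_p = p⁻¹` which is EVEN-REGULAR
(modulo `hMW`, `hCT`, `hGZK`) the premise of B1-sha is contradictory (`sha_noPTorsion_of_evenRegular`), so B1-sha holds there.
[cite: Cassels1962ArithmeticIV] [cite: MazurWiles1984, Thm. 2 (p. 216)] -/
theorem bsdp_of_sha_ne_zero_of_evenRegular (hMW : MazurWiles1984.thm2_card_oddChiClassGroup_eq_bernoulli)
    (hCT : exists_casselsTate_pairing (K := ℚ)) (hGZK : rank_eq_analyticRank_of_analyticRank_le_one)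
    (hCM : W.HasCM) (hram : CMRamified W p) (h5 : 5 ≤ p) (hr : W.analyticRank = 1)
    {f : ℕ} [NeZero f] (ψ : DirichletCharacter ℚ_[p] f) (ω : DirichletCharacter ℚ_[p] p)
    (hψ : ψ.Odd) (hω : IsTeichmullerCharacter ω)
    (hss : ∀ ℓ : ℕ, ℓ.Prime → ¬ (ℓ ∣ p * W.conductorNorm ℤ) →
      ‖((W.LFunction ℓ : ℤ) : ℚ_[p]) - (ψ (ℓ : ZMod f) + ψ⁻¹ (ℓ : ZMod f) * ω (ℓ : ZMod p))‖ < 1)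
    (hB : ‖bernoulliOnePrim ψ⁻¹‖ = (p : ℝ)⁻¹)
    {v : HeightOneSpectrum (𝓞 ℚ)} (hpv : ((p : ℕ) : 𝓞 ℚ) ∈ v.asIdeal)
    (hE : ∀ (Φ : StableSubgroup (absoluteGaloisGroup ℚ) (geomTorsion W (p : ℤ))), Nat.card Φ.Sub = p →
      ∀ c : absoluteGaloisGroup ℚ, IsComplexConjugation (Rat.castHom ℝ) c →
        ((∀ x : Φ.Sub, c • x = x) →
          Nat.card ↥(h1Unramified Φ.Sub (∅ : Set (HeightOneSpectrum (𝓞 ℚ)))) ≤ 1) ∧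
        ((∀ x : Φ.Sub, c • x = -x) →
          Nat.card ↥(h1Unramified Φ.Quot (∅ : Set (HeightOneSpectrum (𝓞 ℚ)))) ≤ 1))
    (hsha : ∃ s ∈ W.sha, s ≠ 0 ∧ p • s = 0) : BSDp W p := by
  exfalso
  obtain ⟨s, hs, hs0, hps⟩ := hsha
  have h := sha_noPTorsion_of_evenRegular W hMW hCT hGZK hCM hram h5 hr ψ ω hψ hω hss hB hpv hE ⟨s, hs⟩
    (Subtype.ext (by rw [AddSubgroupClass.coe_zsmul, ZeroMemClass.coe_zero, natCast_zsmul]; exact hps))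
  exact hs0 (congrArg Subtype.val h)

end Class

end Summit.BirchSwinnertonDyer.BirchSwinnertonDyer.Theorems.PrintCFram.SelmerCount

end
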